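import Literature.NumberTheory.LFunctions.MatomakiRadziwillTaoProp24
import Literature.NumberTheory.LFunctions.TaoLogElliottCMization
import HarnessLib

/-!
# Matomäki–Radziwiłł–Tao 2015, Theorem 2.3 (key exponential sum estimate, discrete form)

K. Matomäki, M. Radziwiłł, T. Tao, *An averaged form of Chowla's conjecture*, Algebra & Number
Theory **9** (2015) 2167–2196 (arXiv:1503.05121), §2: Theorem 2.3 and its deduction from
Proposition 2.4 ("Let us explain why Theorem 2.3 follows from Proposition 2.4 … `g = g₁ * h` …
`∑_d |h(d)| d^{-3/4} = O(1)` …").  Everything in this file is PROVED from the named fact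
`Literature.NumberTheory.LFunctions.MatomakiRadziwillTao2015_theoremA2` (Theorem A.2), through
`MRT2015.prop24_discrete` (`MatomakiRadziwillTaoProp24.lean`).

* `MRT2015.window_convolution_eq` — the Möbius-inversion step: for `g = f * h` (Dirichlet
  convolution), `∑_{x < n ≤ x+L} g(n) w(n) = ∑_b h(b) ∑_{x < bm ≤ x+L} f(m) w(bm)`;
* `MRT2015.keyEstimate_typ` — **Theorem 2.3 in discrete form**: for `g` multiplicative and
  `1`-bounded, written `g = g̃ * h` with `g̃ = cmLift g` completely multiplicative
  (`TaoLogElliottCMization.lean`), in the regime `W = V⁵`, `log L ≤ V`, `V^{1015} ≤ L`,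
  `L V^{75} ≤ X ≤ X₃ ≤ 2X`, `V⁵ ≤ log^{1/125} X`, `M(g; X, V⁵) ≥ 15 log V`:
  `∑_{x ≤ X₃} |∑_{x < n ≤ x+L, n ∈ 𝒮} g(n) e(αn)| ≤ C L X₃ / V`, `𝒮 = 𝒮_{V^{1000}, L/V^{15}, √X₃, X₃}`.
  The scales `b ≤ V³` are fed to Proposition 2.4 (`prop24_discrete`, with `d = b`, `α ↦ bα`), the
  scales `b > V³` are bounded trivially, and the weights are summed with
  `∑_{b ≤ D} |h(b)| b^{-2/3} ≤ C_h` (`sum_defectWeight_le` of `TaoLogElliottCMization.lean`).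

## References
* [MRT2015] Matomäki–Radziwiłł–Tao, Algebra & Number Theory 9 (2015), §2 (Theorem 2.3 and the
  paragraph "Let us explain why Theorem 2.3 follows from Proposition 2.4").
  [cite: MatomakiRadziwillTao2015, Theorem 2.3]

## Design choices / deviations
* The printed exponent `3/4` in `∑_d |h(d)| d^{-3/4}` is replaced by the tree's `2/3`
  (`defectWeight`), and the split of the `d`-sum is at `V³ = W^{3/5}` instead of `W`: with the `L²`
  minor arc bound (decay `d^{-1/2} W^{-3/10}`) this is what balances to the final rate `W^{-1/5}`,
  i.e. `1/log H` for `W = log⁵ H` — slightly better than the printed `(log H)^{1/4} log log H / W^{1/4}`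
  and amply sufficient for Theorem 1.7.
* `W = V⁵` is hard-wired so that all exponents are integral (`D = ⌊V³⌋`, `P₁ = (V⁵)^{200}`,
  `Q₁ = L/(V⁵)³`).
-/

noncomputable section

open Finset Real ArithmeticFunction
open scoped Classical FourierTransform

namespace Literature.NumberTheory.LFunctions

namespace MRT2015

open Literature.NumberTheory.Sieve.Lichtman2020 (windowDiv mem_windowDiv sum_card_windowDiv_le)

/-! ### Möbius inversion inside a window sum -/

/-- **Dirichlet convolution inside a window** ([MRT2015, §2]: "`∑_{x ≤ n ≤ x+H} 1_𝒮 g(n) e(αn)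
= ∑_d h(d) ∑_{x/d ≤ m ≤ x/d+H/d} 1_𝒮(dm) g₁(m) e(dαm)`"): for arithmetic functions `f, h`, a weight
`w` and `x + L ≤ B`,
`∑_{x < n ≤ x+L} (f * h)(n) w(n) = ∑_{1 ≤ b ≤ B} h(b) ∑_{x/b < m ≤ (x+L)/b} f(m) w(bm)`.
[cite: MatomakiRadziwillTao2015, §2 (proof of Theorem 2.3 from Proposition 2.4)] -/
theorem window_convolution_eq (f h : ArithmeticFunction ℂ) (w : ℕ → ℂ) {x L B : ℕ}
    (hB : x + L ≤ B) :
    ∑ n ∈ Ioc x (x + L), (f * h) n * w n =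
      ∑ b ∈ Icc 1 B, h b * ∑ m ∈ Ioc (x / b) ((x + L) / b), f m * w (b * m) := by
  -- expand the convolution over `b ∈ [1, B]`
  have hexp : ∀ n ∈ Ioc x (x + L), (f * h) n * w n =
      ∑ b ∈ Icc 1 B, if b ∣ n then h b * (f (n / b) * w n) else 0 := by
    intro n hn
    rw [Finset.mem_Ioc] at hn
    have hn0 : n ≠ 0 := by omega
    have hnB : n ≤ B := by omega
    rw [ArithmeticFunction.mul_apply, Nat.sum_divisorsAntidiagonal' (fun i j => f i * h j),
      Finset.sum_mul, Tao2016.sum_divisors_eq_sum_Icc_ite _ hn0 hnB]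
    refine Finset.sum_congr rfl fun b _ => ?_
    split_ifs
    · ring
    · rfl
  rw [Finset.sum_congr rfl hexp, Finset.sum_comm]
  refine Finset.sum_congr rfl fun b hb => ?_
  rw [Finset.mem_Icc] at hb
  have hb0 : 0 < b := hb.1
  rw [← Finset.sum_filter, Finset.mul_sum]
  -- re-index `n = b m`
  symm
  refine Finset.sum_nbij' (fun m => b * m) (fun n => n / b) ?_ ?_ ?_ ?_ ?_
  · intro m hm
    rw [Finset.mem_Ioc, Nat.div_lt_iff_lt_mul hb0, Nat.le_div_iff_mul_le hb0] at hm
    rw [Finset.mem_filter, Finset.mem_Ioc]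
    exact ⟨⟨by rw [mul_comm]; exact hm.1, by rw [mul_comm]; exact hm.2⟩, dvd_mul_right b m⟩
  · intro n hn
    rw [Finset.mem_filter, Finset.mem_Ioc] at hn
    obtain ⟨m, rfl⟩ := hn.2
    rw [Nat.mul_div_cancel_left m hb0, Finset.mem_Ioc, Nat.div_lt_iff_lt_mul hb0,
      Nat.le_div_iff_mul_le hb0, mul_comm]
    exact hn.1
  · intro m _
    exact Nat.mul_div_cancel_left m hb0
  · intro n hn
    rw [Finset.mem_filter] at hn
    obtain ⟨m, rfl⟩ := hn.2
    rw [Nat.mul_div_cancel_left m hb0]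
  · intro m _
    rw [Nat.mul_div_cancel_left m hb0]

/-! ### The trivial bound at a large scale -/

/-- **Trivial bound at scale `b`** ([MRT2015, §2]: "we trivially bound this contribution by
`∑ |h(d)| ∑_{m ≤ (2X+H)/d} O(H)`"): for a `1`-bounded summand `c`,
`∑_{x ≤ N} |∑_{x/b < m ≤ (x+L)/b} c(m)| ≤ L (N + 1 + L)/b` (`b, L ≥ 1`).
[cite: MatomakiRadziwillTao2015, §2 (proof of Theorem 2.3 from Proposition 2.4)] -/
theorem sum_norm_scale_trivial {c : ℕ → ℂ} (hc : ∀ m, ‖c m‖ ≤ 1) {b L : ℕ}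
    (hb : 1 ≤ b) (hL : 1 ≤ L) (N : ℕ) :
    ∑ x ∈ range (N + 1), ‖∑ m ∈ Ioc (x / b) ((x + L) / b), c m‖ ≤
      (L : ℝ) * (((N + 1 : ℕ) : ℝ) + L) / b := by
  have h1 : ∀ x ∈ range (N + 1), ‖∑ m ∈ Ioc (x / b) ((x + L) / b), c m‖ ≤
      (#(windowDiv b L (x + 1)) : ℝ) := by
    intro x _
    rw [Ioc_div_eq_windowDiv hb x L]
    refine (norm_sum_le _ _).trans ?_
    calc ∑ m ∈ windowDiv b L (x + 1), ‖c m‖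
        ≤ ∑ m ∈ windowDiv b L (x + 1), (1 : ℝ) := Finset.sum_le_sum fun m _ => hc m
      _ = #(windowDiv b L (x + 1)) := by simp
  refine (Finset.sum_le_sum h1).trans ?_
  rw [sum_range_succ_eq_sum_Icc (fun k => (#(windowDiv b L k) : ℝ)) N]
  exact sum_card_windowDiv_le (N + 1) L b hb hL

/-! ### Non-pretentiousness only sees prime values -/

/-- `M(g; X, Q)` depends only on the values of `g` at primes. [folklore] -/
theorem nonpretentiousness_congr_primes {g g' : ℕ → ℂ} (h : ∀ p : ℕ, p.Prime → g' p = g p)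
    (X Q : ℝ) : Sieve.nonpretentiousness g' X Q = Sieve.nonpretentiousness g X Q := by
  unfold Sieve.nonpretentiousness Sieve.charNonpretentiousness Sieve.pretentiousDistSq
  congr 1; funext q; congr 1; funext χ; congr 1; funext t
  exact Finset.sum_congr rfl fun p hp => by rw [h p (Nat.prime_of_mem_primesLE hp)]

/-! ### The weights `|h(b)|`: consequences of `∑_b |h(b)| b^{-2/3} ≤ C_h` -/

section Weights

variable {g : ArithmeticFunction ℂ}

/-- `|h(b)| b^s = F(b) b^{s + 2/3}` with `F(b) = |h(b)| b^{-2/3}` (`b ≥ 1`). [folklore] -/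
theorem norm_cmDefect_mul_rpow (g : ArithmeticFunction ℂ) {b : ℕ} (hb : 1 ≤ b) (s : ℝ) :
    ‖cmDefect g b‖ * (b : ℝ) ^ s = defectWeight g b * (b : ℝ) ^ (s + 2 / 3) := by
  unfold defectWeight
  have hb0 : (0 : ℝ) < b := by exact_mod_cast hb
  rw [mul_assoc, ← Real.rpow_add hb0]
  norm_num

/-- `∑_{b ≤ D} |h(b)| ≤ C_h D^{2/3}`. [cite: MatomakiRadziwillTao2015, §2 ("from Euler products")] -/
theorem sum_norm_cmDefect_le (hg : g.IsMultiplicative) (hb : ∀ n, ‖g n‖ ≤ 1) (D : ℕ) :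
    ∑ b ∈ Icc 1 D, ‖cmDefect g b‖ ≤ cmDefectBound * (D : ℝ) ^ (2 / 3 : ℝ) := by
  have h1 : ∀ b ∈ Icc 1 D, ‖cmDefect g b‖ ≤ defectWeight g b * (D : ℝ) ^ (2 / 3 : ℝ) := by
    intro b hbD
    rw [Finset.mem_Icc] at hbD
    have e := norm_cmDefect_mul_rpow g hbD.1 0
    rw [Real.rpow_zero, mul_one, zero_add] at e
    rw [e]
    refine mul_le_mul_of_nonneg_left ?_ (defectWeight_nonneg g b)
    exact Real.rpow_le_rpow (Nat.cast_nonneg _) (by exact_mod_cast hbD.2) (by norm_num)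
  refine (Finset.sum_le_sum h1).trans ?_
  rw [← Finset.sum_mul]
  exact mul_le_mul_of_nonneg_right (sum_defectWeight_le g hg hb D) (by positivity)

/-- `∑_{b ≤ D} |h(b)|/b ≤ C_h`. [cite: MatomakiRadziwillTao2015, §2 ("from Euler products")] -/
theorem sum_norm_cmDefect_div_le (hg : g.IsMultiplicative) (hb : ∀ n, ‖g n‖ ≤ 1) (D : ℕ) :
    ∑ b ∈ Icc 1 D, ‖cmDefect g b‖ / b ≤ cmDefectBound := by
  have h1 : ∀ b ∈ Icc 1 D, ‖cmDefect g b‖ / b ≤ defectWeight g b := by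
    intro b hbD
    rw [Finset.mem_Icc] at hbD
    have hb0 : (0 : ℝ) < b := by exact_mod_cast hbD.1
    have e := norm_cmDefect_mul_rpow g hbD.1 (-1)
    rw [Real.rpow_neg_one, ← div_eq_mul_inv] at e
    rw [e]
    have h2 : (b : ℝ) ^ ((-1 : ℝ) + 2 / 3) ≤ 1 :=
      Real.rpow_le_one_of_one_le_of_nonpos (by exact_mod_cast hbD.1) (by norm_num)
    calc defectWeight g b * (b : ℝ) ^ ((-1 : ℝ) + 2 / 3) ≤ defectWeight g b * 1 :=
          mul_le_mul_of_nonneg_left h2 (defectWeight_nonneg g b)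
      _ = defectWeight g b := mul_one _
  exact (Finset.sum_le_sum h1).trans (sum_defectWeight_le g hg hb D)

/-- `∑_{b ≤ D} |h(b)|/√b ≤ C_h D^{1/6}`. [cite: MatomakiRadziwillTao2015, §2 ("from Euler products")] -/
theorem sum_norm_cmDefect_div_sqrt_le (hg : g.IsMultiplicative) (hb : ∀ n, ‖g n‖ ≤ 1) (D : ℕ) :
    ∑ b ∈ Icc 1 D, ‖cmDefect g b‖ / Real.sqrt b ≤ cmDefectBound * (D : ℝ) ^ (1 / 6 : ℝ) := by
  have h1 : ∀ b ∈ Icc 1 D, ‖cmDefect g b‖ / Real.sqrt b ≤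
      defectWeight g b * (D : ℝ) ^ (1 / 6 : ℝ) := by
    intro b hbD
    rw [Finset.mem_Icc] at hbD
    have hb0 : (0 : ℝ) < b := by exact_mod_cast hbD.1
    have e := norm_cmDefect_mul_rpow g hbD.1 (-(1 / 2))
    rw [Real.rpow_neg hb0.le, ← Real.sqrt_eq_rpow, ← div_eq_mul_inv] at e
    rw [e]
    refine mul_le_mul_of_nonneg_left ?_ (defectWeight_nonneg g b)
    rw [show (-(1 / 2) : ℝ) + 2 / 3 = 1 / 6 by norm_num]
    exact Real.rpow_le_rpow (Nat.cast_nonneg _) (by exact_mod_cast hbD.2) (by norm_num)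
  refine (Finset.sum_le_sum h1).trans ?_
  rw [← Finset.sum_mul]
  exact mul_le_mul_of_nonneg_right (sum_defectWeight_le g hg hb D) (by positivity)

/-- `∑_{D < b ≤ B} |h(b)|/b ≤ C_h (D+1)^{-1/3}`. [cite: MatomakiRadziwillTao2015, §2 ("from Euler products")] -/
theorem sum_norm_cmDefect_div_tail_le (hg : g.IsMultiplicative) (hb : ∀ n, ‖g n‖ ≤ 1)
    (D B : ℕ) :
    ∑ b ∈ Ioc D B, ‖cmDefect g b‖ / b ≤ cmDefectBound * ((D : ℝ) + 1) ^ (-(1 / 3) : ℝ) := by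
  have h1 : ∀ b ∈ Ioc D B, ‖cmDefect g b‖ / b ≤
      defectWeight g b * ((D : ℝ) + 1) ^ (-(1 / 3) : ℝ) := by
    intro b hbD
    rw [Finset.mem_Ioc] at hbD
    have hb1 : 1 ≤ b := by omega
    have hb0 : (0 : ℝ) < b := by exact_mod_cast hb1
    have e := norm_cmDefect_mul_rpow g hb1 (-1)
    rw [Real.rpow_neg_one, ← div_eq_mul_inv] at e
    rw [e, show (-1 : ℝ) + 2 / 3 = -(1 / 3) by norm_num]
    refine mul_le_mul_of_nonneg_left ?_ (defectWeight_nonneg g b)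
    have hDb : (D : ℝ) + 1 ≤ b := by exact_mod_cast hbD.1
    exact Real.rpow_le_rpow_of_nonpos (by positivity) hDb (by norm_num)
  refine (Finset.sum_le_sum h1).trans ?_
  rw [← Finset.sum_mul]
  refine mul_le_mul_of_nonneg_right ?_ (by positivity)
  calc ∑ b ∈ Ioc D B, defectWeight g b ≤ ∑ b ∈ Icc 1 B, defectWeight g b := by
        refine Finset.sum_le_sum_of_subset_of_nonneg (fun b hb' => ?_)
          (fun b _ _ => defectWeight_nonneg g b)
        rw [Finset.mem_Ioc] at hb'
        rw [Finset.mem_Icc]; omega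
    _ ≤ cmDefectBound := sum_defectWeight_le g hg hb B

/-- `C_h > 0`. [folklore] -/
theorem cmDefectBound_pos : 0 < cmDefectBound := Real.exp_pos _

end Weights

/-! ### Powers of `V` (`W = V⁵`, `D = ⌊V³⌋`) -/

/-- `V ≤ (V⁵)^{1/4}` for `V ≥ 1`. [folklore] -/
theorem le_pow_five_rpow_quarter {V : ℝ} (hV : 1 ≤ V) : V ≤ (V ^ 5) ^ (1 / 4 : ℝ) := by
  have hV0 : 0 ≤ V := by linarith
  have e : (V ^ 4) ^ (1 / 4 : ℝ) = V := by
    rw [show (1 / 4 : ℝ) = ((4 : ℕ) : ℝ)⁻¹ by norm_num]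
    exact Real.pow_rpow_inv_natCast hV0 (by norm_num)
  calc V = (V ^ 4) ^ (1 / 4 : ℝ) := e.symm
    _ ≤ (V ^ 5) ^ (1 / 4 : ℝ) :=
        Real.rpow_le_rpow (by positivity) (pow_le_pow_right₀ hV (by norm_num)) (by norm_num)

/-- `√(V⁵) = V² √V`. [folklore] -/
theorem sqrt_pow_five (V : ℝ) : Real.sqrt (V ^ 5) = V ^ 2 * Real.sqrt V := by
  rw [show V ^ 5 = (V ^ 2) ^ 2 * V by ring, Real.sqrt_mul (by positivity), Real.sqrt_sq (by positivity)]

/-- `⌊V³⌋^{2/3} ≤ V²`, `⌊V³⌋^{1/6} ≤ √V`, `(⌊V³⌋ + 1)^{-1/3} ≤ V⁻¹` (`V ≥ 1`). [folklore] -/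
theorem floor_cube_rpow_bounds {V : ℝ} (hV : 1 ≤ V) :
    ((⌊V ^ 3⌋₊ : ℕ) : ℝ) ^ (2 / 3 : ℝ) ≤ V ^ 2 ∧
      ((⌊V ^ 3⌋₊ : ℕ) : ℝ) ^ (1 / 6 : ℝ) ≤ Real.sqrt V ∧
        (((⌊V ^ 3⌋₊ : ℕ) : ℝ) + 1) ^ (-(1 / 3) : ℝ) ≤ V⁻¹ := by
  have hV0 : 0 ≤ V := by linarith
  have hV0' : 0 < V := by linarith
  have hD : ((⌊V ^ 3⌋₊ : ℕ) : ℝ) ≤ V ^ 3 := Nat.floor_le (by positivity)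
  have hD1 : V ^ 3 ≤ ((⌊V ^ 3⌋₊ : ℕ) : ℝ) + 1 := (Nat.lt_floor_add_one _).le
  have e3 : (V ^ 3 : ℝ) = V ^ (3 : ℝ) := by rw [← Real.rpow_natCast]; norm_num
  refine ⟨?_, ?_, ?_⟩
  · calc ((⌊V ^ 3⌋₊ : ℕ) : ℝ) ^ (2 / 3 : ℝ) ≤ (V ^ 3) ^ (2 / 3 : ℝ) :=
          Real.rpow_le_rpow (Nat.cast_nonneg _) hD (by norm_num)
      _ = V ^ 2 := by
          rw [e3, ← Real.rpow_mul hV0]; norm_num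
  · calc ((⌊V ^ 3⌋₊ : ℕ) : ℝ) ^ (1 / 6 : ℝ) ≤ (V ^ 3) ^ (1 / 6 : ℝ) :=
          Real.rpow_le_rpow (Nat.cast_nonneg _) hD (by norm_num)
      _ = Real.sqrt V := by
          rw [e3, ← Real.rpow_mul hV0, Real.sqrt_eq_rpow]; norm_num
  · calc (((⌊V ^ 3⌋₊ : ℕ) : ℝ) + 1) ^ (-(1 / 3) : ℝ) ≤ (V ^ 3) ^ (-(1 / 3) : ℝ) :=
          Real.rpow_le_rpow_of_nonpos (by positivity) hD1 (by norm_num)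
      _ = V⁻¹ := by
          rw [e3, ← Real.rpow_mul hV0, ← Real.rpow_neg_one]; norm_num

/-! ### Theorem 2.3, discrete form -/

/-- The weight `1_𝒮(n) e(αn)` is `1`-bounded. [folklore] -/
theorem norm_ite_fourierChar_le (s : Finset ℕ) (α : ℝ) (n : ℕ) :
    ‖(if n ∈ s then ((𝐞 (α * n) : ℂ)) else 0)‖ ≤ 1 := by
  split_ifs
  · exact (norm_fourierChar_le_one _)
  · rw [norm_zero]; exact zero_le_one

set_option maxHeartbeats 1600000 in
/-- **[MRT2015, Theorem 2.3] (key exponential sum estimate) in discrete form, from Theorem A.2.**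
There are absolute `C, V₀, X⁎` such that for `g` multiplicative and `1`-bounded, `V ≥ V₀`,
heights `X⁎ ≤ X ≤ X₃ ≤ 2X`, a window `L` with `log L ≤ V`, `V^{1015} ≤ L`, `L V^{75} ≤ X`,
`L ≤ exp(√(log X / 2))`, `V⁵ ≤ log^{1/125} X` and `M(g; X, V⁵) ≥ 15 log V` (hypothesis (2-1) with
`W = V⁵`), for every real `α`,
`∑_{x ≤ X₃} |∑_{x < n ≤ x+L, n ∈ 𝒮} g(n) e(αn)| ≤ C L X₃ / V`, `𝒮 = 𝒮_{W^{200}, L/W³, √X₃, X₃}`.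
Proof as printed: `g = g̃ * h` (`cmLift`, `cmDefect`), the scales `b ≤ V³` by Proposition 2.4
(`prop24_discrete` at scale `b` and frequency `bα`, using `1_𝒮(bm) = 1_{𝒮_{X₃/b}}(m)`), the scales
`b > V³` trivially, and `∑ |h(b)| b^{-2/3} ≤ C_h`. [cite: MatomakiRadziwillTao2015, Theorem 2.3] -/
theorem keyEstimate_typ (hA2 : MatomakiRadziwillTao2015_theoremA2) :
    ∃ C V₀ Xs : ℝ, 0 < C ∧ ∀ (X X₃ V : ℝ) (L : ℕ) (α : ℝ) (g : ArithmeticFunction ℂ),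
      g.IsMultiplicative → (∀ n, ‖g n‖ ≤ 1) →
      Xs ≤ X → X ≤ X₃ → X₃ ≤ 2 * X → V₀ ≤ V → V ^ 5 ≤ Real.log X ^ (1 / 125 : ℝ) →
      V ^ 1015 ≤ (L : ℝ) → (L : ℝ) * V ^ 75 ≤ X →
      (L : ℝ) ≤ Real.exp (Real.sqrt (Real.log X / 2)) →
      Real.log L ≤ V → 15 * Real.log V ≤ Sieve.nonpretentiousness g X (V ^ 5) →
      ∑ x ∈ range (⌊X₃⌋₊ + 1), ‖∑ n ∈ Ioc x (x + L),
          typFun g ((V ^ 5) ^ 200) (L / (V ^ 5) ^ 3) (Real.sqrt X₃) X₃ n * (𝐞 (α * n) : ℂ)‖ ≤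
        C * L * X₃ / V := by
  obtain ⟨C₁, W₀, X₁, hC₁, h24⟩ := prop24_discrete hA2
  have hCh := cmDefectBound_pos
  refine ⟨(4 * C₁ + 3) * cmDefectBound, max W₀ 3, max X₁ 1, by positivity, ?_⟩
  intro X X₃ V L α g hg hg1 hXs hXX₃ hX₃ hV₀ hVX hVL hLX hLexp hlogL hM
  -- basics
  have hV3 : 3 ≤ V := (le_max_right _ _).trans hV₀
  have hV1 : 1 ≤ V := by linarith
  have hV0 : 0 < V := by linarith
  have hX₁ : X₁ ≤ X := (le_max_left _ _).trans hXs
  have hX1 : 1 ≤ X := (le_max_right _ _).trans hXs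
  have hX₃1 : 1 ≤ X₃ := hX1.trans hXX₃
  have hX₃0 : 0 < X₃ := by linarith
  set W : ℝ := V ^ 5 with hW
  have hVW : V ≤ W := le_self_pow₀ hV1 (by norm_num)
  have hW₀ : W₀ ≤ W := ((le_max_left _ _).trans hV₀).trans hVW
  have hW1 : 1 ≤ W := hV1.trans hVW
  have hW0 : 0 < W := by linarith
  have hW3 : 3 ≤ W := hV3.trans hVW
  have hWL : W ^ 203 ≤ (L : ℝ) := by rw [hW, ← pow_mul]; exact hVL
  have hLW15 : (L : ℝ) * W ^ 15 ≤ X := by rw [hW, ← pow_mul]; exact hLX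
  have hLW : W ≤ (L : ℝ) := le_trans (le_self_pow₀ hW1 (by norm_num)) hWL
  have hL1 : (1 : ℝ) ≤ L := hW1.trans hLW
  have hL0 : (0 : ℝ) < L := by linarith
  have hL : 1 ≤ L := by exact_mod_cast hL1
  have hlogL0 : 0 ≤ Real.log L := Real.log_nonneg hL1
  have hlogL5 : Real.log L ^ 5 ≤ W := pow_le_pow_left₀ hlogL0 hlogL 5
  have hLX' : (L : ℝ) ≤ X :=
    le_trans (le_mul_of_one_le_right hL0.le (one_le_pow₀ hW1)) hLW15
  have hLX₃ : (L : ℝ) ≤ X₃ := hLX'.trans hXX₃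
  set N := ⌊X₃⌋₊ with hN
  have hNX : (N : ℝ) ≤ X₃ := Nat.floor_le hX₃0.le
  set P₁ : ℝ := W ^ 200 with hP₁
  set Q₁ : ℝ := L / W ^ 3 with hQ₁
  set X₀ : ℝ := Real.sqrt X₃ with hX₀
  -- the decomposition `g = g̃ * h`
  set gt := cmLift g with hgt
  set h := cmDefect g with hh
  have hgt1 : ∀ n, ‖gt n‖ ≤ 1 := norm_cmLift_le_one g (fun p _ => hg1 p)
  have hgtmul : ∀ m n : ℕ, gt (m * n) = gt m * gt n := cmLift_mul g
  have hgt_one : gt 1 = 1 := (isMultiplicative_cmLift g).map_one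
  have hMgt : 3 * Real.log W ≤ Sieve.nonpretentiousness gt X W := by
    rw [nonpretentiousness_congr_primes (fun p hp => cmLift_prime g hp) X W]
    have e : Real.log W = 5 * Real.log V := by rw [hW, Real.log_pow]; push_cast; ring
    rw [e]; linarith
  -- `P₁ > 1`, `log Q₁ ≥ 1`
  have hP1 : 1 < P₁ := by rw [hP₁]; exact one_lt_pow₀ (by linarith) (by norm_num)
  have hWP : W ≤ P₁ := by rw [hP₁]; exact le_self_pow₀ hW1 (by norm_num)
  have hlog3 : 1 ≤ Real.log 3 := by
    rw [← Real.log_exp 1]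
    refine Real.log_le_log (Real.exp_pos 1) ?_
    have := Real.exp_one_lt_d9; linarith
  have hlogW : 1 ≤ Real.log W := hlog3.trans (Real.log_le_log (by norm_num) hW3)
  have hQW : W ≤ Q₁ := by
    rw [hQ₁, le_div_iff₀ (by positivity)]
    calc W * W ^ 3 = W ^ 4 := by ring
      _ ≤ W ^ 203 := pow_le_pow_right₀ hW1 (by norm_num)
      _ ≤ L := hWL
  have hQ1 : 1 ≤ Real.log Q₁ := hlogW.trans (Real.log_le_log hW0 hQW)
  -- the split point `D = ⌊V³⌋`
  set D : ℕ := ⌊V ^ 3⌋₊ with hD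
  have hDV : (D : ℝ) ≤ V ^ 3 := Nat.floor_le (by positivity)
  have hV3W : V ^ 3 < W := by rw [hW]; exact pow_lt_pow_right₀ (by linarith) (by norm_num)
  have hDP : (D : ℝ) < P₁ := by linarith
  obtain ⟨hD23, hD16, hD13⟩ := floor_cube_rpow_bounds hV1
  -- the weight `w` and the window sums at each scale
  set w : ℕ → ℂ := fun n => if n ∈ typicalSet P₁ Q₁ X₀ X₃ then ((𝐞 (α * n) : ℂ)) else 0
    with hw
  have hw1 : ∀ n, ‖w n‖ ≤ 1 := fun n => norm_ite_fourierChar_le _ α n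
  set U : ℕ → ℕ → ℂ := fun b x => ∑ m ∈ Ioc (x / b) ((x + L) / b), gt m * w (b * m) with hU
  set B := N + L with hB
  -- Step 1: Möbius inversion in every window
  have hstep1 : ∀ x ∈ range (N + 1), ∑ n ∈ Ioc x (x + L),
      typFun g P₁ Q₁ X₀ X₃ n * (𝐞 (α * n) : ℂ) = ∑ b ∈ Icc 1 B, h b * U b x := by
    intro x hx
    have hxN : x ≤ N := Nat.lt_succ_iff.mp (Finset.mem_range.mp hx)
    have e1 : ∀ n, typFun g P₁ Q₁ X₀ X₃ n * (𝐞 (α * n) : ℂ) = (gt * h) n * w n := by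
      intro n
      rw [hgt, hh, cmLift_mul_cmDefect]
      unfold typFun
      rw [hw]; dsimp only
      split_ifs <;> simp
    simp_rw [e1]
    exact window_convolution_eq gt h w (by omega)
  -- Step 2: small scales `b ≤ D`, by Proposition 2.4 at scale `b` and frequency `bα`
  have hsmall : ∀ b ∈ Icc 1 D, ∑ x ∈ range (N + 1), ‖U b x‖ ≤
      C₁ * L * X₃ * (1 / V ^ 10 + (1 / V) * (1 / b) +
        (2 / (V * Real.sqrt V)) * (1 / Real.sqrt b)) := by
    intro b hb
    rw [Finset.mem_Icc] at hb
    have hb0 : 0 < b := hb.1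
    have hb1 : (1 : ℝ) ≤ b := by exact_mod_cast hb.1
    have hb0' : (0 : ℝ) < b := by linarith
    have hbD : (b : ℝ) ≤ D := by exact_mod_cast hb.2
    have hbW : (b : ℝ) < W := by linarith
    have hsmallp : ∀ p : ℕ, p.Prime → p ∣ b → (p : ℝ) < P₁ := fun p _ hpb => by
      have hpb' : (p : ℝ) ≤ b := by exact_mod_cast Nat.le_of_dvd hb0 hpb
      linarith
    -- identify `U b x` with the summand of Proposition 2.4 at scale `b`, frequency `bα`
    have hUeq : ∀ x, U b x = ∑ m ∈ Ioc (x / b) ((x + L) / b),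
        typFun gt P₁ Q₁ X₀ (X₃ / b) m * (𝐞 ((α * b) * m) : ℂ) := by
      intro x
      rw [hU]; dsimp only
      refine Finset.sum_congr rfl fun m _ => ?_
      rw [hw]; dsimp only
      unfold typFun
      have e : α * ((b * m : ℕ) : ℝ) = α * b * m := by push_cast; ring
      by_cases hm : m ∈ typicalSet P₁ Q₁ X₀ (X₃ / b)
      · rw [if_pos hm, if_pos ((mul_mem_typicalSet_iff hb0 hP1 hQ1 hsmallp).mpr hm), e, mul_comm]
      · rw [if_neg hm, if_neg (fun h' => hm ((mul_mem_typicalSet_iff hb0 hP1 hQ1 hsmallp).mp h')),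
          mul_zero, zero_mul]
    simp_rw [hUeq]
    have h := h24 X X₃ W L b (α * b) gt hgtmul hgt_one hgt1 hX₁ hXX₃ hX₃ hW₀ hVX hb.1 hbW
      hWL hLW15 hLexp hlogL5 hMgt
    refine h.trans ?_
    -- from `W`-terms to `V`-terms
    have e1 : 1 / W ^ 2 = 1 / V ^ 10 := by rw [hW]; ring
    have e2 : 1 / ((b : ℝ) * W ^ (1 / 4 : ℝ)) ≤ (1 / V) * (1 / b) := by
      rw [one_div_mul_one_div]
      refine one_div_le_one_div_of_le (by positivity) ?_
      rw [mul_comm V]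
      exact mul_le_mul_of_nonneg_left (le_pow_five_rpow_quarter hV1) hb0'.le
    have e3 : (1 + Real.log L) / Real.sqrt (b * W) ≤
        (2 / (V * Real.sqrt V)) * (1 / Real.sqrt b) := by
      rw [Real.sqrt_mul hb0'.le, hW, sqrt_pow_five V, div_mul_div_comm, mul_one]
      rw [div_le_div_iff₀ (by positivity) (by positivity)]
      have hsV : 0 < Real.sqrt V := Real.sqrt_pos.mpr hV0
      have hsb : 0 < Real.sqrt b := Real.sqrt_pos.mpr hb0'
      have hl : 1 + Real.log L ≤ 2 * V := by linarith
      calc (1 + Real.log L) * (V * Real.sqrt V * Real.sqrt b)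
          ≤ (2 * V) * (V * Real.sqrt V * Real.sqrt b) :=
            mul_le_mul_of_nonneg_right hl (by positivity)
        _ = 2 * (Real.sqrt b * (V ^ 2 * Real.sqrt V)) := by ring
    have hsum : 1 / W ^ 2 + 1 / ((b : ℝ) * W ^ (1 / 4 : ℝ)) + (1 + Real.log L) / Real.sqrt (b * W)
        ≤ 1 / V ^ 10 + (1 / V) * (1 / b) + (2 / (V * Real.sqrt V)) * (1 / Real.sqrt b) := by
      rw [e1]; linarith
    exact mul_le_mul_of_nonneg_left hsum (by positivity)
  -- Step 3: large scales `b > D`, trivially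
  have hlarge : ∀ b ∈ Ioc D B, ∑ x ∈ range (N + 1), ‖U b x‖ ≤ 3 * L * X₃ * (1 / b) := by
    intro b hb
    rw [Finset.mem_Ioc] at hb
    have hb1 : 1 ≤ b := by omega
    have hb0' : (0 : ℝ) < b := by exact_mod_cast hb1
    have hc : ∀ m, ‖gt m * w (b * m)‖ ≤ 1 := fun m => by
      rw [norm_mul]; exact mul_le_one₀ (hgt1 m) (norm_nonneg _) (hw1 _)
    have h1 := sum_norm_scale_trivial hc hb1 hL N
    refine h1.trans ?_
    rw [mul_one_div, div_le_div_iff_of_pos_right hb0']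
    push_cast
    nlinarith
  -- Step 4: summation over the scales
  have hxbound : ∀ x ∈ range (N + 1), ‖∑ n ∈ Ioc x (x + L),
      typFun g P₁ Q₁ X₀ X₃ n * (𝐞 (α * n) : ℂ)‖ ≤ ∑ b ∈ Icc 1 B, ‖h b‖ * ‖U b x‖ := by
    intro x hx
    rw [hstep1 x hx]
    refine (norm_sum_le _ _).trans (Finset.sum_le_sum fun b _ => ?_)
    rw [norm_mul]
  have hsub : Icc 1 B ⊆ Icc 1 D ∪ Ioc D B := by
    intro b hb
    rw [Finset.mem_union, Finset.mem_Icc, Finset.mem_Ioc]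
    rw [Finset.mem_Icc] at hb
    omega
  have hdisj : Disjoint (Icc 1 D) (Ioc D B) := by
    rw [Finset.disjoint_left]
    intro b hb hb'
    rw [Finset.mem_Icc] at hb
    rw [Finset.mem_Ioc] at hb'
    omega
  -- the four weight sums
  have hS0 : ∑ b ∈ Icc 1 D, ‖h b‖ ≤ cmDefectBound * V ^ 2 :=
    (sum_norm_cmDefect_le hg hg1 D).trans (mul_le_mul_of_nonneg_left hD23 hCh.le)
  have hS1 : ∑ b ∈ Icc 1 D, ‖h b‖ / b ≤ cmDefectBound := sum_norm_cmDefect_div_le hg hg1 D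
  have hS2 : ∑ b ∈ Icc 1 D, ‖h b‖ / Real.sqrt b ≤ cmDefectBound * Real.sqrt V :=
    (sum_norm_cmDefect_div_sqrt_le hg hg1 D).trans (mul_le_mul_of_nonneg_left hD16 hCh.le)
  have hS3 : ∑ b ∈ Ioc D B, ‖h b‖ / b ≤ cmDefectBound * V⁻¹ :=
    (sum_norm_cmDefect_div_tail_le hg hg1 D B).trans (mul_le_mul_of_nonneg_left hD13 hCh.le)
  calc ∑ x ∈ range (N + 1), ‖∑ n ∈ Ioc x (x + L), typFun g P₁ Q₁ X₀ X₃ n * (𝐞 (α * n) : ℂ)‖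
      ≤ ∑ x ∈ range (N + 1), ∑ b ∈ Icc 1 B, ‖h b‖ * ‖U b x‖ := Finset.sum_le_sum hxbound
    _ = ∑ b ∈ Icc 1 B, ‖h b‖ * ∑ x ∈ range (N + 1), ‖U b x‖ := by
        rw [Finset.sum_comm]
        exact Finset.sum_congr rfl fun b _ => by rw [Finset.mul_sum]
    _ ≤ ∑ b ∈ Icc 1 D ∪ Ioc D B, ‖h b‖ * ∑ x ∈ range (N + 1), ‖U b x‖ :=
        Finset.sum_le_sum_of_subset_of_nonneg hsub fun b _ _ =>
          mul_nonneg (norm_nonneg _) (Finset.sum_nonneg fun _ _ => norm_nonneg _)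
    _ = ∑ b ∈ Icc 1 D, ‖h b‖ * ∑ x ∈ range (N + 1), ‖U b x‖ +
          ∑ b ∈ Ioc D B, ‖h b‖ * ∑ x ∈ range (N + 1), ‖U b x‖ := Finset.sum_union hdisj
    _ ≤ ∑ b ∈ Icc 1 D, ‖h b‖ * (C₁ * L * X₃ * (1 / V ^ 10 + (1 / V) * (1 / b) +
            (2 / (V * Real.sqrt V)) * (1 / Real.sqrt b))) +
          ∑ b ∈ Ioc D B, ‖h b‖ * (3 * L * X₃ * (1 / b)) := by
        gcongr with b hb b hb
        · exact hsmall b hb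
        · exact hlarge b hb
    _ = C₁ * L * X₃ * ((1 / V ^ 10) * ∑ b ∈ Icc 1 D, ‖h b‖ +
            (1 / V) * ∑ b ∈ Icc 1 D, ‖h b‖ / b +
            (2 / (V * Real.sqrt V)) * ∑ b ∈ Icc 1 D, ‖h b‖ / Real.sqrt b) +
          3 * L * X₃ * ∑ b ∈ Ioc D B, ‖h b‖ / b := by
        rw [Finset.mul_sum, Finset.mul_sum, Finset.mul_sum, Finset.mul_sum,
          ← Finset.sum_add_distrib, ← Finset.sum_add_distrib, Finset.mul_sum]
        congr 1
        · exact Finset.sum_congr rfl fun b _ => by ring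
        · exact Finset.sum_congr rfl fun b _ => by ring
    _ ≤ C₁ * L * X₃ * ((1 / V ^ 10) * (cmDefectBound * V ^ 2) + (1 / V) * cmDefectBound +
            (2 / (V * Real.sqrt V)) * (cmDefectBound * Real.sqrt V)) +
          3 * L * X₃ * (cmDefectBound * V⁻¹) := by
        gcongr
    _ = cmDefectBound * L * X₃ * (C₁ * (1 / V ^ 8 + 1 / V + 2 / V) + 3 / V) := by
        have hsV : Real.sqrt V ≠ 0 := (Real.sqrt_pos.mpr hV0).ne'
        field_simp
    _ ≤ cmDefectBound * L * X₃ * (C₁ * (1 / V + 1 / V + 2 / V) + 3 / V) := by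
        have h8 : 1 / V ^ 8 ≤ 1 / V := by
          refine one_div_le_one_div_of_le hV0 ?_
          exact le_self_pow₀ hV1 (by norm_num)
        have h0 : 0 ≤ cmDefectBound * L * X₃ := by positivity
        gcongr
    _ = (4 * C₁ + 3) * cmDefectBound * L * X₃ / V := by ring

end MRT2015

end Literature.NumberTheory.LFunctions

end
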